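import Mathlib.AlgebraicGeometry.EllipticCurve.Affine.Point
import Literature.Computability.Complexity.CodeFPModArith
import HarnessLib

/-!
# Route EcdlpDefinability — definitions for the `EcdlpInNP` verifier (objects the route posits)

The polynomial-time verifier of `EcdlpInNP` (stmt-PneNP-2075) computes the group law of a Weierstrass curve over
`𝔽_p` on RESIDUES (naturals below the modulus, `Literature.Computability.Complexity.ModArith`), the modulus and the
coefficients being part of the input. This file only fixes those residue-level objects:

* `ecdlpNegY`, `ecdlpSlope`, `ecdlpAddX`, `ecdlpAddY`: the formulas `negY`, `slope`, `addX`, `addY` of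
  `Mathlib.AlgebraicGeometry.EllipticCurve.Affine` written with `addM/mulM/subM/negM/invM`;
* `ecdlpAdd`: the affine addition on triples `(flag, x, y)` (`flag = 0` is the point at infinity), the case split of
  `WeierstrassCurve.Affine.Point.add`;
* `ecdlpStep`, `ecdlpSmul`: double-and-add over the binary digits of the multiplier (least significant first);
* `ecdlpPt`: the point of `W(𝔽_p)` represented by a triple of canonical residues (`Option`-valued).

Their meaning (`= Mathlib's group law` for a prime modulus) and their polynomial-time computation on codes are proved in
`EcdlpDefinabilityEcdlpArith.lean` / `EcdlpDefinabilityEcdlpProgram.lean`.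
-/

set_option linter.dupNamespace false -- `Summit.PneNP.PneNP.…`: summit = sub-problem name (D-0017 single-conjunct layout)

namespace Summit.PneNP.PneNP.Theorems

open Literature.Computability.Complexity.ModArith

/-- `negY x y = -y - a₁x - a₃` on residues modulo `p`. [cite: SilvermanAEC2009, III.2.3] -/
def ecdlpNegY (p a₁ a₃ x y : ℕ) : ℕ := subM p (subM p (negM p y) (mulM p a₁ x)) a₃

/-- The slope of the line through `(x₁, y₁)`, `(x₂, y₂)` (tangent slope `(3x₁² + 2a₂x₁ + a₄ - a₁y₁)/(y₁ - negY x₁ y₁)`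
when `x₁ = x₂`), on residues modulo `p`, inverses by Fermat (`invM`). [cite: SilvermanAEC2009, III.2.3] -/
def ecdlpSlope (p a₁ a₂ a₃ a₄ x₁ y₁ x₂ y₂ : ℕ) : ℕ :=
  if x₁ = x₂ then
    mulM p (subM p (addM p (addM p (mulM p 3 (mulM p x₁ x₁)) (mulM p (mulM p 2 a₂) x₁)) a₄) (mulM p a₁ y₁))
      (invM p (subM p y₁ (ecdlpNegY p a₁ a₃ x₁ y₁)))
  else mulM p (subM p y₁ y₂) (invM p (subM p x₁ x₂))

/-- `addX x₁ x₂ L = L² + a₁L - a₂ - x₁ - x₂` on residues. [cite: SilvermanAEC2009, III.2.3] -/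
def ecdlpAddX (p a₁ a₂ x₁ x₂ L : ℕ) : ℕ := subM p (subM p (subM p (addM p (mulM p L L) (mulM p a₁ L)) a₂) x₁) x₂

/-- `addY x₁ x₂ y₁ L = negY X (L(X - x₁) + y₁)`, `X = addX x₁ x₂ L`, on residues. [cite: SilvermanAEC2009, III.2.3] -/
def ecdlpAddY (p a₁ a₃ x₁ y₁ X L : ℕ) : ℕ := ecdlpNegY p a₁ a₃ X (addM p (mulM p L (subM p X x₁)) y₁)

/-- **Affine addition on triples `(flag, x, y)`** (`flag = 0`: the point at infinity), following the case split of
`WeierstrassCurve.Affine.Point.add`. [cite: SilvermanAEC2009, III.2.3] -/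
def ecdlpAdd (p a₁ a₂ a₃ a₄ : ℕ) (P Q : ℕ × ℕ × ℕ) : ℕ × ℕ × ℕ :=
  if P.1 = 0 then Q else if Q.1 = 0 then P else
  if P.2.1 = Q.2.1 ∧ P.2.2 = ecdlpNegY p a₁ a₃ Q.2.1 Q.2.2 then (0, 0, 0) else
  (1, ecdlpAddX p a₁ a₂ P.2.1 Q.2.1 (ecdlpSlope p a₁ a₂ a₃ a₄ P.2.1 P.2.2 Q.2.1 Q.2.2),
    ecdlpAddY p a₁ a₃ P.2.1 P.2.2 (ecdlpAddX p a₁ a₂ P.2.1 Q.2.1 (ecdlpSlope p a₁ a₂ a₃ a₄ P.2.1 P.2.2 Q.2.1 Q.2.2))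
      (ecdlpSlope p a₁ a₂ a₃ a₄ P.2.1 P.2.2 Q.2.1 Q.2.2))

/-- One double-and-add step at binary digit `i` of the multiplier `m`: `(R, S) ↦ (R + [mᵢ = 1] S, 2S)`.
[cite: SilvermanAEC2009, XI.1 (double-and-add)] -/
def ecdlpStep (p a₁ a₂ a₃ a₄ m i : ℕ) (st : (ℕ × ℕ × ℕ) × (ℕ × ℕ × ℕ)) : (ℕ × ℕ × ℕ) × (ℕ × ℕ × ℕ) :=
  (if m / 2 ^ i % 2 = 1 then ecdlpAdd p a₁ a₂ a₃ a₄ st.1 st.2 else st.1, ecdlpAdd p a₁ a₂ a₃ a₄ st.2 st.2)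

/-- **Double-and-add**: `m • P` on triples, over the `B` least significant binary digits of `m` (correct once `m < 2^B`).
[cite: SilvermanAEC2009, XI.1 (double-and-add)] -/
def ecdlpSmul (p a₁ a₂ a₃ a₄ B m : ℕ) (P : ℕ × ℕ × ℕ) : ℕ × ℕ × ℕ :=
  ((List.range B).foldl (fun st i => ecdlpStep p a₁ a₂ a₃ a₄ m i st) ((0, 0, 0), P)).1

/-- **The point represented by a triple** of canonical residues: `(0, 0, 0)` is the point at infinity, `(1, x, y)` with
`x, y < p` and `(x, y)` nonsingular on `W` is that affine point; anything else represents nothing. [folklore] -/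
noncomputable def ecdlpPt {p : ℕ} (W : WeierstrassCurve.Affine (ZMod p)) (u : ℕ × ℕ × ℕ) : Option W.Point := by
  classical
  exact if u = (0, 0, 0) then some 0
    else if h : u.1 = 1 ∧ u.2.1 < p ∧ u.2.2 < p ∧ W.Nonsingular (u.2.1 : ZMod p) (u.2.2 : ZMod p) then
      some (WeierstrassCurve.Affine.Point.some (u.2.1 : ZMod p) (u.2.2 : ZMod p) h.2.2.2)
    else none

end Summit.PneNP.PneNP.Theorems
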